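import Summits.ValiantsHypothesis.ValiantsHypothesis.Theorems.DepthWindowHomNewtonValues
import HarnessLib

/-!
# Route `DepthWindow`, g8 — Newton gadget (4/4): the one-step lemma `newton_step`

Given the new block `Ψ₀` built so far and the positional invariant for the old gates `j < i`
(values agree modulo weight `> d`, depth entries at most doubled), the next old gate is realised
by a block `Y`: a translated copy of a sum gate, or the Newton gadget of a product gate.  Output:
product fan-in `≤ 2d`, `|Y| ≤ (i + d + 2)² · 2^(d+2)`, every new depth entry `≤ 2 ·` (old entry),
and the last gate of `Y` carries the old value modulo weight `> d`.  Consumed by the block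
induction proving `HomRel k (2k)` (`DepthWindowHomRelTwoMul`).

[cite: LimayeSrinivasanTavenas2025, Lemma 11, Lemma 19, Lemma 20] [cite: Strassen1973, §3]
[cite: Burgisser2000, Def. 2.1]
-/

-- layout Summits/ValiantsHypothesis/ValiantsHypothesis forces the duplicated namespace component
set_option linter.dupNamespace false

namespace Summit.ValiantsHypothesis.ValiantsHypothesis.Theorems.DepthWindow

open MvPolynomial Literature.Computability.AlgebraicComplexity ArithCircuit
open Literature.Computability.AlgebraicComplexity.DepthReduction

/-! ### The one-step lemma -/

section Step

variable {k : Type*} [Field k] [Algebra ℚ k] {τ : Type*}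

omit [Algebra ℚ k] in
/-- Translated operands agree with the old ones modulo weight `> d` (positional invariant). -/
theorem below_top_eval (w : τ → ℕ) (d i : ℕ) (pos : ℕ → ℕ) (Ψ₀ : List (Gate k τ))
    (vals : List (MvPolynomial τ k)) (hvals : vals.length = i)
    (hval : ∀ j < i, below w (d + 1) ((gateValues Ψ₀).getD (pos j) 0) =
      below w (d + 1) (vals.getD j 0)) :
    ∀ u : Operand k τ, below w (d + 1) ((top i pos u).eval (gateValues Ψ₀)) =
      below w (d + 1) (u.eval vals)
  | .var _ => rfl
  | .const _ => rfl
  | .gate j => by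
      simp only [top]
      split_ifs with h
      · rw [Operand.eval_gate, Operand.eval_gate]; exact hval j h
      · rw [Operand.eval_gate, List.getD_eq_default _ _ (by omega),
          show (Operand.const (0 : k) : Operand k τ).eval (gateValues Ψ₀) = C 0 from rfl, map_zero]

/-- The gadget appended to `Ψ₀` is `psi4 ++ [F]`. -/
theorem append_gadget_eq (i : ℕ) (pos : ℕ → ℕ) (c : ℕ → k) (us : List (Operand k τ)) (d : ℕ)
    (cc : (kk : ℕ) → kk.Partition → ℚ) (Ψ₀ : List (Gate k τ)) :
    Ψ₀ ++ gadget i pos c us d Ψ₀.length cc =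
      psi4 i pos c us d Ψ₀ ++ [gateF i pos c us d Ψ₀.length cc] := by
  simp [gadget, psi4, psi3, psi2, psi1, List.append_assoc]

/-- **One step of the Newton normalisation.**  Given the new block `Ψ₀` so far, positions
`pos j` of the old gates `j < i` with values agreeing modulo weight `> d` and depth entries at
most doubled, the next old gate `g` is realised by a block `Y` (one translated sum gate, or the
Newton gadget of a product gate): product fan-in `≤ 2d`, `|Y| ≤ (i + d + 2)² 2^(d+2)`, every new
depth entry `≤ 2 ·` (the entry of `g`), and the LAST gate of `Y` has the value of `g` modulo
weight `> d` at depth `≤ 2 ·` (the entry of `g`).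
[cite: LimayeSrinivasanTavenas2025, Lemma 11] [cite: Strassen1973, §3] -/
theorem newton_step (w : τ → ℕ) (hw : ∀ t, 1 ≤ w t) (d : ℕ) (Ψ₀ : List (Gate k τ)) (i : ℕ)
    (pos : ℕ → ℕ) (vals : List (MvPolynomial τ k)) (ds : List ℕ)
    (hpos : ∀ j < i, pos j < Ψ₀.length) (hvals : vals.length = i)
    (hval : ∀ j < i, below w (d + 1) ((gateValues Ψ₀).getD (pos j) 0) =
      below w (d + 1) (vals.getD j 0))
    (hdep : ∀ j < i, (gateWDepths prodWeight Ψ₀).getD (pos j) 0 ≤ 2 * ds.getD j 0)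
    (g : Gate k τ) :
    ∃ Y : List (Gate k τ),
      (∀ vs : List (Operand k τ), Gate.prod vs ∈ Y → vs.length ≤ 2 * d) ∧
      Y.length ≤ (i + d + 2) ^ 2 * 2 ^ (d + 2) ∧ 0 < Y.length ∧
      (∀ x ∈ gateWDepths prodWeight (Ψ₀ ++ Y),
        x ∈ gateWDepths prodWeight Ψ₀ ∨ x ≤ 2 * Gate.depthAgainst prodWeight ds g) ∧
      below w (d + 1) ((gateValues (Ψ₀ ++ Y)).getD (Ψ₀.length + Y.length - 1) 0) =
        below w (d + 1) (g.eval vals) ∧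
      (gateWDepths prodWeight (Ψ₀ ++ Y)).getD (Ψ₀.length + Y.length - 1) 0 ≤
        2 * Gate.depthAgainst prodWeight ds g := by
  have hbig : 1 ≤ (i + d + 2) ^ 2 * 2 ^ (d + 2) :=
    le_trans (by norm_num) (Nat.mul_le_mul (Nat.one_le_pow _ _ (by omega)) Nat.one_le_two_pow)
  have hV₀len : (gateValues Ψ₀).length = Ψ₀.length := gateValues_length Ψ₀
  have hD₀len : (gateWDepths prodWeight Ψ₀).length = Ψ₀.length := gateWDepths_length _ Ψ₀
  cases g with
  | sum args =>
      refine ⟨[Gate.sum (args.map fun a => (a.1, top i pos a.2))], ?_, by simpa using hbig,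
        by simp, ?_, ?_, ?_⟩
      · intro vs hvs; simp at hvs
      · intro x hx
        rw [gateWDepths_append_singleton, List.mem_append, List.mem_singleton] at hx
        rcases hx with hx | rfl
        · exact Or.inl hx
        · exact Or.inr (depthAgainst_sum_top_le i pos hdep args)
      · rw [List.length_singleton, Nat.add_sub_cancel, gateValues_append_singleton,
          getD_append_at_length _ _ _ hV₀len.symm, eval_sum, eval_sum, List.map_map]
        exact below_list_sum_map_congr w args Prod.fst (fun a => (top i pos a.2).eval (gateValues Ψ₀))
          (fun a => a.2.eval vals) fun a _ => below_top_eval w d i pos Ψ₀ vals hvals hval a.2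
      · rw [List.length_singleton, Nat.add_sub_cancel, gateWDepths_append_singleton,
          getD_append_at_length _ _ _ hD₀len.symm]
        exact depthAgainst_sum_top_le i pos hdep args
  | prod us =>
      -- constant coefficients of the old values, and the Newton coefficients
      set c : ℕ → k := fun j => coeff 0 (vals.getD j 0) with hc_def
      have hc : ∀ j < i, coeff 0 ((gateValues Ψ₀).getD (pos j) 0) = c j :=
        fun j hj => coeff_zero_eq_of_below_eq w (Nat.succ_pos d) (hval j hj)
      obtain ⟨cc, hcc⟩ := exists_cc_gateF i pos c us d (Ψ₀ := Ψ₀) w hw hpos hc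
      set L := Ψ₀.length with hL
      -- the depth lists, layer by layer
      set D₀ := gateWDepths prodWeight Ψ₀ with hD₀
      set δ₀ := (us.map (Operand.depthIn ds)).foldr max 0 with hδ₀
      have hdg : Gate.depthAgainst prodWeight ds (Gate.prod us) = 1 + δ₀ := depthAgainst_prod ds us
      set EdB := (layerB i pos c us).map (Gate.depthAgainst prodWeight D₀) with hEdB
      have hD1 : gateWDepths prodWeight (psi1 i pos c us Ψ₀) = D₀ ++ EdB :=
        gateWDepths_append_block prodWeight Ψ₀ _ (layerB_argsBelow i pos c us hpos)
      have hB : ∀ x ∈ EdB, x ≤ 2 * δ₀ := by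
        intro x hx
        rw [hEdB, List.mem_map] at hx
        obtain ⟨G, hG, rfl⟩ := hx
        simp only [layerB, List.mem_map, List.mem_range] at hG
        obtain ⟨j, _, rfl⟩ := hG
        exact depthAgainst_gateB_le i pos c us hdep j
      have hEdBlen : EdB.length = i := by rw [hEdB, List.length_map, length_layerB]
      set EdW := (layerW i d L : List (Gate k τ)).map
        (Gate.depthAgainst prodWeight (gateWDepths prodWeight (psi1 i pos c us Ψ₀))) with hEdW
      have hD2 : gateWDepths prodWeight (psi2 i pos c us d Ψ₀) =
          gateWDepths prodWeight (psi1 i pos c us Ψ₀) ++ EdW :=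
        gateWDepths_append_block prodWeight _ _ (by
          rw [length_psi1]; exact layerW_argsBelow i d L)
      have hW : ∀ x ∈ EdW, x ≤ 2 * δ₀ + 1 := by
        intro x hx
        rw [hEdW, List.mem_map] at hx
        obtain ⟨G, hG, rfl⟩ := hx
        rw [hD1]
        exact depthAgainst_layerW_le i d hD₀len hB G hG
      have hEdWlen : EdW.length = i * (d + 1) := by rw [hEdW, List.length_map, length_layerW]
      set EdP := (layerP i c us d L).map
        (Gate.depthAgainst prodWeight (gateWDepths prodWeight (psi2 i pos c us d Ψ₀))) with hEdP
      have hD3 : gateWDepths prodWeight (psi3 i pos c us d Ψ₀) =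
          gateWDepths prodWeight (psi2 i pos c us d Ψ₀) ++ EdP :=
        gateWDepths_append_block prodWeight _ _ (by
          rw [length_psi2]; exact layerP_argsBelow i c us d L)
      have hP : ∀ x ∈ EdP, x ≤ 2 * δ₀ + 1 := by
        intro x hx
        rw [hEdP, List.mem_map] at hx
        obtain ⟨G, hG, rfl⟩ := hx
        rw [hD2]
        exact depthAgainst_layerP_le i c us d
          (by rw [gateWDepths_length, length_psi1]) hW G hG
      set EdM := (layerM i pos c us d L).map
        (Gate.depthAgainst prodWeight (gateWDepths prodWeight (psi3 i pos c us d Ψ₀))) with hEdM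
      have hD4 : gateWDepths prodWeight (psi4 i pos c us d Ψ₀) =
          gateWDepths prodWeight (psi3 i pos c us d Ψ₀) ++ EdM :=
        gateWDepths_append_block prodWeight _ _ (by
          rw [length_psi3]; exact layerM_argsBelow i pos c us d hpos)
      have hM : ∀ x ∈ EdM, x ≤ 2 * δ₀ + 2 := by
        intro x hx
        rw [hEdM, List.mem_map] at hx
        obtain ⟨G, hG, rfl⟩ := hx
        rw [hD3, hD2, hD1, List.append_assoc D₀]
        exact depthAgainst_layerM_le i pos c us d hD₀len hpos
          (fun u hu => depthIn_zkeep_le i pos c us d hdep hu)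
          (by rw [List.length_append, List.length_append, hD₀len, hEdBlen, hEdWlen]; omega) hP G hG
      have hD5 : gateWDepths prodWeight (Ψ₀ ++ gadget i pos c us d L cc) =
          gateWDepths prodWeight (psi4 i pos c us d Ψ₀) ++
            [Gate.depthAgainst prodWeight (gateWDepths prodWeight (psi4 i pos c us d Ψ₀))
              (gateF i pos c us d L cc)] := by
        rw [append_gadget_eq, gateWDepths_append_singleton]; rfl
      have hF : Gate.depthAgainst prodWeight (gateWDepths prodWeight (psi4 i pos c us d Ψ₀))
          (gateF i pos c us d L cc) ≤ 2 * δ₀ + 2 := by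
        rw [hD4]
        exact depthAgainst_gateF_le i pos c us d cc (by rw [gateWDepths_length, length_psi3]) hM
      have hidx : Ψ₀.length + (gadget i pos c us d L cc).length - 1 =
          (psi4 i pos c us d Ψ₀).length := by
        rw [length_gadget, length_psi4]; omega
      refine ⟨gadget i pos c us d L cc, fanIn_gadget i pos c us d L cc,
        length_gadget_le i pos c us d L cc, by rw [length_gadget]; omega, ?_, ?_, ?_⟩
      · -- every new depth entry
        intro x hx
        rw [hdg]
        rw [hD5, List.mem_append, List.mem_singleton] at hx
        rcases hx with hx | rfl
        · rw [hD4, List.mem_append] at hx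
          rcases hx with hx | hx
          · rw [hD3, List.mem_append] at hx
            rcases hx with hx | hx
            · rw [hD2, List.mem_append] at hx
              rcases hx with hx | hx
              · rw [hD1, List.mem_append] at hx
                rcases hx with hx | hx
                · exact Or.inl hx
                · right; have := hB x hx; omega
              · right; have := hW x hx; omega
            · right; have := hP x hx; omega
          · right; have := hM x hx; omega
        · right; omega
      · -- the value of the last gate
        rw [hidx, append_gadget_eq, gateValues_append_singleton,
          getD_append_at_length _ _ _ (gateValues_length _).symm, hcc, eval_prod]
        exact below_list_prod_map_congr w us _ _ fun u _ =>
          below_top_eval w d i pos Ψ₀ vals hvals hval u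
      · -- the depth of the last gate
        rw [hidx, hD5, getD_append_at_length _ _ _ (gateWDepths_length _ _).symm, hdg]
        omega

end Step

end Summit.ValiantsHypothesis.ValiantsHypothesis.Theorems.DepthWindow
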